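import Mathlib
import Summits.CriticalPhenomena.CardyFormulaZ2.Theorems.CardySelfRefinementDefs
import Literature.Probability.Percolation.SelfRefinementMeasure
import HarnessLib

/-!
# Crux `GradientComparability` (stmt-CriticalPhenomena-10269), line `monotone-product-coordinates`:
# stub `stub_monotoneRep`, part A — the block criterion for product representations of `M_k(ρ,c)`

Route `CardySelfRefinement`, sub-problem `CriticalPhenomena/CardyFormulaZ2`; vocabulary (`ax`, `tb`,
`cfg`, `prm`, `M`, …) from `CardySelfRefinementDefs` (`M k ρ c` is the tree's
`selfRefinementMeasure k ρ c` by `rfl`), block vocabulary (`FKGBlock`, `coinSlot`, `fkgParam`,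
`fkgCode`, `FKGOpen`, `fkgConfig`, `fkgBlockLaw`) from
`Literature/Probability/Percolation/SelfRefinementMeasure.lean`.

## Mathematics

The tree represents the route's law `M_k(ρ,c)` as the image, under the increasing map `fkgConfig k`,
of a product over the blocks `FKGBlock = (Site 2 × Fin 2) × Fin 2` of laws on the chain `Fin 4`
(`selfRefinementMeasure_eq_map_fkgConfig`): the coins are realised inside the enlarged product over
`FKGBlock × Fin 2`, curried into independent two-coin blocks, and each block is CODED in `Fin 4`
(own block `(b, 0)`: `3`/`0` by the own coin; tuple block `(b, 1)`: forced open `3`, forced closed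
`0`, free `1` or `2`); `fkgConfig k` only reads the thresholds `≥ 1` and `≥ 3` of the codes.

This file turns that bookkeeping into a CRITERION (`monoRep_M_eq_map_of_blocks`): any coin product
`prodBernoulli p` with a measurable read-out `F` that admits a consistent block coding — block
parameters `Q` extending `p` along `coinSlot`, block codes `C` such that `fkgConfig k` read off the
codes is `F` (`monoRep_map_prodBernoulli_eq_map_fkgConfig`, the generic form of the tree's proof) —
and whose block laws agree with the tree's `fkgBlockLaw k ρ c` after merging the two free codes
`1, 2 ↦ 1` (a recoding preserving both thresholds, hence `fkgConfig k`:
`monoRep_map_fkgConfig_eq_of_comp`) satisfies `M k ρ c = (prodBernoulli p).map F`.  It also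
computes the four atoms of the merged law of a tuple block of the route's model
(`monoRep_fkgBlockLaw_one_collapse_atoms`: forced closed `ρ/2`, free `1-ρ`, forced open `ρ/2`,
by the two-coin rectangle computation `monoRep_twoCoin_map_apply_singleton`).  Part B
(`…StubMonotoneRep.lean`) applies the criterion to the monotone product coordinates of the stub.
Everything is uniform in `k` (including the degenerate `k = 0, 1`) and in `c ∈ ℝ`.
-/

noncomputable section

namespace Summit.CriticalPhenomena.CardyFormulaZ2.Theorems.CardySelfRefinement

open scoped Topology ENNReal
open Filter Set MeasureTheory ProbabilityTheory
open Literature.Probability.LatticeModels Literature.Probability.Percolation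
open Literature.Probability.Percolation.QuadCrossing
open Summit.CriticalPhenomena.CardyFormulaZ2.Theses.CardySelfRefinement

/-! ## Block representations of push-forwards of the coin product -/

-- adapted from `selfRefinementMeasure_eq_map_fkgConfig` (Literature/Probability/Percolation/SelfRefinementMeasure.lean)
/-- **Generic block representation.**  Let the coins `Site 2 × Fin 2 × Fin 3` be realised, along
the tree's `coinSlot`, inside the enlarged coin space `FKGBlock × Fin 2` with block parameters `Q`
(`hQ`), and let `C o` code the two coins of the block `o` in the chain `Fin 4` consistently with a
read-out `F` of the coins (`hC`: the tree's opening rule `fkgConfig k` read off the codes is `F`).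
Then the push-forward of the coin product `prodBernoulli p` under `F` is the image under
`fkgConfig k` of the product of the block laws `(⨂ₗ Ber(Q o l)).map (C o)`.  Same bookkeeping as
the tree's `selfRefinementMeasure_eq_map_fkgConfig` (the case `Q = fkgParam`, `C = fkgCode`,
`F = refinementConfig k`): `Measure.map_infinitePi_infinitePi_of_inj`, `Measure.infinitePi_map_curry`,
`Measure.infinitePi_map_pi`. -/
theorem monoRep_map_prodBernoulli_eq_map_fkgConfig (k : ℕ) {p : Site 2 × Fin 2 × Fin 3 → unitInterval}
    {F : Set (Site 2 × Fin 2 × Fin 3) → BondConfig (Site 2)} (hF : Measurable F)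
    (Q : FKGBlock → Fin 2 → unitInterval) (C : FKGBlock → (Fin 2 → Prop) → Fin 4)
    (hQ : ∀ i, Q (coinSlot i).1 (coinSlot i).2 = p i)
    (hC : ∀ ω : FKGBlock × Fin 2 → Prop, fkgConfig k (fun o => C o fun l => ω (o, l)) = F {i | ω (coinSlot i)}) :
    (prodBernoulli p).map F =
      (Measure.infinitePi fun o : FKGBlock =>
        (Measure.infinitePi fun l : Fin 2 => (Ber(True, False, Q o l) : Measure Prop)).map (C o)).map
        (fkgConfig k) := by
  obtain rfl : p = fun i => Q (coinSlot i).1 (coinSlot i).2 := funext fun i => (hQ i).symm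
  have hcode : ∀ o : FKGBlock, Measurable (C o) := fun o => measurable_of_countable _
  have hrestr : Measurable fun (ω : FKGBlock × Fin 2 → Prop) (i : Site 2 × Fin 2 × Fin 3) => ω (coinSlot i) :=
    measurable_pi_lambda _ fun i => measurable_pi_apply _
  have hblock : Measurable fun (h : FKGBlock → Fin 2 → Prop) (o : FKGBlock) => C o (h o) :=
    measurable_pi_lambda _ fun o => (hcode o).comp (measurable_pi_apply o)
  have hcur : Measurable (MeasurableEquiv.curry FKGBlock (Fin 2) Prop) := MeasurableEquiv.measurable _
  -- the right-hand side as an image of the enlarged coin product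
  have hR : (Measure.infinitePi fun o : FKGBlock =>
        (Measure.infinitePi fun l : Fin 2 => (Ber(True, False, Q o l) : Measure Prop)).map (C o)) =
      ((Measure.infinitePi fun q : FKGBlock × Fin 2 =>
          (Ber(True, False, Q q.1 q.2) : Measure Prop)).map
        (MeasurableEquiv.curry FKGBlock (Fin 2) Prop)).map (fun h o => C o (h o)) := by
    rw [Measure.infinitePi_map_curry (fun o l => (Ber(True, False, Q o l) : Measure Prop))]
    exact (Measure.infinitePi_map_pi _ hcode).symm
  -- the left-hand side as an image of the enlarged coin product
  have hL : (prodBernoulli fun i => Q (coinSlot i).1 (coinSlot i).2).map F =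
      (((Measure.infinitePi fun q : FKGBlock × Fin 2 =>
          (Ber(True, False, Q q.1 q.2) : Measure Prop)).map
        (fun ω i => ω (coinSlot i))).map (fun q : Site 2 × Fin 2 × Fin 3 → Prop => {i | q i})).map F := by
    rw [Measure.map_infinitePi_infinitePi_of_inj
        (P := fun q : FKGBlock × Fin 2 => (Ber(True, False, Q q.1 q.2) : Measure Prop)) coinSlot_injective,
      prodBernoulli_eq_map]
    rfl
  rw [hL, hR, Measure.map_map measurable_setOf hrestr, Measure.map_map hF (measurable_setOf.comp hrestr),
    Measure.map_map hblock hcur, Measure.map_map (measurable_fkgConfig k) (hblock.comp hcur)]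
  congr 1
  funext ω
  exact (hC ω).symm

/-! ## Recoding the blocks without changing the thresholds `≥ 1`, `≥ 3` -/

/-- The opening rule in block coordinates only reads the thresholds `≥ 1` and `≥ 3` of the codes:
recoding every block by a map `cm` preserving both thresholds does not change it. -/
theorem monoRep_fkgOpen_comp_iff (k : ℕ) {cm : Fin 4 → Fin 4} (h3 : ∀ x, 3 ≤ cm x ↔ 3 ≤ x)
    (h1 : ∀ x, 1 ≤ cm x ↔ 1 ≤ x) (W : FKGBlock → Fin 4) (e : Site 2 × Fin 2) :
    FKGOpen k (cm ∘ W) e ↔ FKGOpen k W e := by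
  unfold FKGOpen
  simp only [Function.comp_apply, h3, h1]

/-- Recoding by a threshold-preserving map does not change the configuration. -/
theorem monoRep_fkgConfig_comp (k : ℕ) {cm : Fin 4 → Fin 4} (h3 : ∀ x, 3 ≤ cm x ↔ 3 ≤ x)
    (h1 : ∀ x, 1 ≤ cm x ↔ 1 ≤ x) (W : FKGBlock → Fin 4) : fkgConfig k (cm ∘ W) = fkgConfig k W := by
  unfold fkgConfig
  congr 1
  ext e
  exact monoRep_fkgOpen_comp_iff k h3 h1 W e

/-- **Two block products whose block laws agree after a threshold-preserving recoding have the same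
configuration law.** -/
theorem monoRep_map_fkgConfig_eq_of_comp {k : ℕ} {cm : Fin 4 → Fin 4} (h3 : ∀ x, 3 ≤ cm x ↔ 3 ≤ x)
    (h1 : ∀ x, 1 ≤ cm x ↔ 1 ≤ x) {L L' : FKGBlock → Measure (Fin 4)}
    [∀ o, IsProbabilityMeasure (L o)] [∀ o, IsProbabilityMeasure (L' o)]
    (h : ∀ o, (L o).map cm = (L' o).map cm) :
    (Measure.infinitePi L).map (fkgConfig k) = (Measure.infinitePi L').map (fkgConfig k) := by
  have hmode : Measurable cm := measurable_of_countable _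
  have hpi : Measurable fun (W : FKGBlock → Fin 4) (o : FKGBlock) => cm (W o) :=
    measurable_pi_lambda _ fun o => hmode.comp (measurable_pi_apply o)
  have hcollapse : ∀ (L'' : FKGBlock → Measure (Fin 4)) [∀ o, IsProbabilityMeasure (L'' o)],
      (Measure.infinitePi L'').map (fkgConfig k) =
        (Measure.infinitePi fun o => (L'' o).map cm).map (fkgConfig k) := by
    intro L'' _
    have hcomp : fkgConfig k = fkgConfig k ∘ fun (W : FKGBlock → Fin 4) (o : FKGBlock) => cm (W o) :=
      funext fun W => (monoRep_fkgConfig_comp k h3 h1 W).symm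
    calc (Measure.infinitePi L'').map (fkgConfig k)
        = (Measure.infinitePi L'').map
            (fkgConfig k ∘ fun (W : FKGBlock → Fin 4) (o : FKGBlock) => cm (W o)) := by rw [← hcomp]
      _ = ((Measure.infinitePi L'').map
            (fun (W : FKGBlock → Fin 4) (o : FKGBlock) => cm (W o))).map (fkgConfig k) :=
          (Measure.map_map (measurable_fkgConfig k) hpi).symm
      _ = (Measure.infinitePi fun o => (L'' o).map cm).map (fkgConfig k) := by
          rw [Measure.infinitePi_map_pi _ (fun _ => hmode)]
  rw [hcollapse L, hcollapse L']
  congr 2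
  funext o
  exact h o

/-! ## Two-coin blocks: atoms of the coded laws -/

/-- **Two-coin rectangle computation**: the mass of the atom `a` of the image of two independent
coins under a code `Fc` whose fibre over `a` is the rectangle `t₀ × t₁`. -/
theorem monoRep_twoCoin_map_apply_singleton (q : Fin 2 → unitInterval) (Fc : (Fin 2 → Prop) → Fin 4)
    (a : Fin 4) (t₀ t₁ : Set Prop) (hFc : ∀ g : Fin 2 → Prop, Fc g = a ↔ (g 0 ∈ t₀ ∧ g 1 ∈ t₁)) :
    ((Measure.infinitePi fun l : Fin 2 => (Ber(True, False, q l) : Measure Prop)).map Fc) {a} =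
      Ber(True, False, q 0) t₀ * Ber(True, False, q 1) t₁ := by
  rw [Measure.map_apply (measurable_of_countable Fc) (measurableSet_singleton a)]
  have hpre : Fc ⁻¹' {a} = Set.pi Set.univ ![t₀, t₁] := by
    ext g
    simp only [Set.mem_preimage, Set.mem_singleton_iff, hFc, Set.mem_univ_pi, Fin.forall_fin_two,
      Matrix.cons_val_zero, Matrix.cons_val_one]
  rw [hpre, Measure.infinitePi_eq_pi, Measure.pi_pi, Fin.prod_univ_two]
  rfl

/-- A statement about all four elements of `Fin 4` from its four instances. -/
theorem monoRep_forall_fin4 {P : Fin 4 → Prop} (h0 : P 0) (h1 : P 1) (h2 : P 2) (h3 : P 3) :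
    ∀ a, P a := by
  intro a
  fin_cases a
  · exact h0
  · exact h1
  · exact h2
  · exact h3

/-- **The atoms of the recoded law of a tuple block of the route's model** (`ρ ∈ [0,1]`): with the
shared fair coin `h` (slot `0`) and the selector `s` of bias `ρ` (slot `1`) coded by the tree's
`fkgCode` and the two "free" codes `1, 2` merged into `1`: forced closed (`s ∧ ¬h`, code `0`) has
mass `ρ/2`, free (`¬s`, code `1`) mass `1 - ρ`, code `2` no mass, forced open (`s ∧ h`, code `3`)
mass `ρ/2`. -/
theorem monoRep_fkgBlockLaw_one_collapse_atoms (k : ℕ) {ρ : ℝ} (hρ : ρ ∈ Set.Icc (0 : ℝ) 1) (c : ℝ)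
    (b : Site 2 × Fin 2) :
    ((fkgBlockLaw k ρ c (b, 1)).map (fun x : Fin 4 => if x = 2 then 1 else x)) {0} = ENNReal.ofReal (ρ / 2) ∧
    ((fkgBlockLaw k ρ c (b, 1)).map (fun x : Fin 4 => if x = 2 then 1 else x)) {1} = ENNReal.ofReal (1 - ρ) ∧
    ((fkgBlockLaw k ρ c (b, 1)).map (fun x : Fin 4 => if x = 2 then 1 else x)) {2} = 0 ∧
    ((fkgBlockLaw k ρ c (b, 1)).map (fun x : Fin 4 => if x = 2 then 1 else x)) {3} = ENNReal.ofReal (ρ / 2) := by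
  have hcm : Measurable (fun x : Fin 4 => if x = 2 then (1 : Fin 4) else x) := measurable_of_countable _
  rw [fkgBlockLaw, Measure.map_map hcm (measurable_of_countable _)]
  have h0v : ((fkgParam k ρ c (b, 1) 0 : unitInterval) : ℝ) = 1 / 2 := by simp [fkgParam]
  have h1v : ((fkgParam k ρ c (b, 1) 1 : unitInterval) : ℝ) = ρ := by
    simp [fkgParam, Set.projIcc_of_mem _ hρ]
  refine ⟨?_, ?_, ?_, ?_⟩
  · -- forced closed: `s ∧ ¬ h`
    rw [monoRep_twoCoin_map_apply_singleton _ _ _ {False} {True} fun g => by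
        by_cases h0 : g 0 <;> by_cases h1 : g 1 <;> simp [fkgCode, h0, h1]]
    rw [bernoulliMeasure_prop_apply_false, bernoulliMeasure_prop_apply_true, h0v, h1v,
      ← ENNReal.ofReal_mul (by norm_num)]
    congr 1
    ring
  · -- free: `¬ s`
    rw [monoRep_twoCoin_map_apply_singleton _ _ _ Set.univ {False} fun g => by
        by_cases h0 : g 0 <;> by_cases h1 : g 1 <;> simp [fkgCode, h0, h1]]
    rw [measure_univ, one_mul, bernoulliMeasure_prop_apply_false, h1v]
  · -- the merged code `2`: no mass
    rw [monoRep_twoCoin_map_apply_singleton _ _ _ ∅ Set.univ fun g => by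
        by_cases h0 : g 0 <;> by_cases h1 : g 1 <;> simp [fkgCode, h0, h1]]
    rw [measure_empty, zero_mul]
  · -- forced open: `s ∧ h`
    rw [monoRep_twoCoin_map_apply_singleton _ _ _ {True} {True} fun g => by
        by_cases h0 : g 0 <;> by_cases h1 : g 1 <;> simp [fkgCode, h0, h1]]
    rw [bernoulliMeasure_prop_apply_true, bernoulliMeasure_prop_apply_true, h0v, h1v,
      ← ENNReal.ofReal_mul (by norm_num)]
    congr 1
    ring

/-! ## The block criterion -/

/-- **Block criterion for a product representation of `M_k(ρ,c)`.**  If a coin product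
`prodBernoulli p` with read-out `F` admits a consistent block coding (`Q`, `C`, as in
`monoRep_map_prodBernoulli_eq_map_fkgConfig`) whose block laws agree with the tree's block laws
`fkgBlockLaw k ρ c` of `M_k(ρ,c)` after merging the two "free" codes `1, 2` of `Fin 4` (a recoding
preserving the thresholds `≥ 1`, `≥ 3` read by `fkgConfig k`), then `M k ρ c = (prodBernoulli p).map F`.
Proof: both sides are images under `fkgConfig k` of block products
(`selfRefinementMeasure_eq_map_fkgConfig`, `monoRep_map_prodBernoulli_eq_map_fkgConfig`), and
`monoRep_map_fkgConfig_eq_of_comp`. -/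
theorem monoRep_M_eq_map_of_blocks (k : ℕ) (ρ c : ℝ) {p : Site 2 × Fin 2 × Fin 3 → unitInterval}
    {F : Set (Site 2 × Fin 2 × Fin 3) → BondConfig (Site 2)} (hF : Measurable F)
    (Q : FKGBlock → Fin 2 → unitInterval) (C : FKGBlock → (Fin 2 → Prop) → Fin 4)
    (hQ : ∀ i, Q (coinSlot i).1 (coinSlot i).2 = p i)
    (hC : ∀ ω : FKGBlock × Fin 2 → Prop, fkgConfig k (fun o => C o fun l => ω (o, l)) = F {i | ω (coinSlot i)})
    (hlaw : ∀ o : FKGBlock,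
      ((Measure.infinitePi fun l : Fin 2 =>
          (ProbabilityTheory.bernoulliMeasure True False (Q o l) : Measure Prop)).map (C o)).map
        (fun x : Fin 4 => if x = 2 then 1 else x) =
      (fkgBlockLaw k ρ c o).map (fun x : Fin 4 => if x = 2 then 1 else x)) :
    M k ρ c = (prodBernoulli p).map F := by
  haveI : ∀ o : FKGBlock, IsProbabilityMeasure ((Measure.infinitePi fun l : Fin 2 =>
      (ProbabilityTheory.bernoulliMeasure True False (Q o l) : Measure Prop)).map (C o)) :=
    fun o => Measure.isProbabilityMeasure_map (measurable_of_countable _).aemeasurable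
  calc M k ρ c = (Measure.infinitePi (fkgBlockLaw k ρ c)).map (fkgConfig k) :=
        selfRefinementMeasure_eq_map_fkgConfig k ρ c
    _ = (Measure.infinitePi fun o : FKGBlock => (Measure.infinitePi fun l : Fin 2 =>
          (ProbabilityTheory.bernoulliMeasure True False (Q o l) : Measure Prop)).map (C o)).map
          (fkgConfig k) :=
        (monoRep_map_fkgConfig_eq_of_comp (cm := fun x : Fin 4 => if x = 2 then 1 else x)
          (by decide) (by decide) hlaw).symm
    _ = (prodBernoulli p).map F := (monoRep_map_prodBernoulli_eq_map_fkgConfig k hF Q C hQ hC).symm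

end Summit.CriticalPhenomena.CardyFormulaZ2.Theorems.CardySelfRefinement

end
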